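/-
Copyright (c) 2026. All rights reserved.
Released under Apache 2.0 license as described in the file LICENSE.
Authors: abc-iut cell, prover seat abc-iut-L4-t5 (gen 10; row «F3757-PORT», abc-iut-L4-lead m147 (5)), over abc-iut-f-101's
`DiagramPathEmbeddings.lean` (`LiftPair`) / `DiagramSinkSystems.lean` (sink pre-families) and files 1–2 of this mover.
-/
import Literature.AnabelianGeometry.AbsoluteAnabelian.DiagramPathEmbeddings
import Literature.AnabelianGeometry.AbsoluteAnabelian.DiagramOverHomotopies
import HarnessLib

/-!
# [AbsTopIII] Def 3.5 (ii) bookkeeping: `eqToHom`-conjugated whiskerings (shape lemmas), and the pre-composition law of a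
# sub-diagram's family read in the big diagram WITHOUT a sieve (toolkit for Cor 5.5 (iii) inside `D_{An•}`)

S. Mochizuki, *Topics in absolute anabelian geometry III: global reconstruction algorithms*,
J. Math. Sci. Univ. Tokyo 22 (2015) 939–1156 [MochizukiAbsTopIII2015]; manuscript `paper:url-5493eb38cbb7`, locators read on the
page: Def 3.5 (ii) p. 75 (families of homotopies: identity on the diagonal, composition, whiskering; "compatible" = contained in
ONE family), (iii) p. 75 (observables), (iv) p. 76 (telecores: boundary pairs `([γ₃]∘[γ₁], [γ₃]∘[γ₂])`), Cor 5.5 (ii) p. 130 (the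
telecore `𝔗_{An•}`, edges `φ_⋏ = φ_{An•}` back into the first rows), (iii) p. 131 ("the families of homotopies that constitute `S_log`
and `S_log⊞` are compatible with one another as well as with the families of homotopies that constitute the core and telecore
structures of (i), (ii)"), Rmk 3.5.1 p. 78 (structure functors).

WHAT (row «F3757-PORT», file 3a of the mover; generic).  In the telecore diagram `D_{An•}` the homotopy of an OUTER member pair
(file 3b) is a composite of whiskered pieces living over path functors that agree only PROPOSITIONALLY (`D_[γ∘ρ] = D_[γ] ∘ D_[ρ]`);
the laws of Def 3.5 (ii) for such composites are proved here once, over VARIABLE functors (so that the identifications can be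
substituted away):

* `outerShape_comp/_split/_id/_tail_id/_head_id`, `whiskerLeft_outerShape`, `whiskerLeft_conj_whiskerLeft`,
  `whiskerRight_conj_whiskerLeft/_whiskerRight`, `whiskerRight_functor_congr`, `app_conj_whiskerLeft/Right`, and `eqToHom`
  bookkeeping (`eqToHom_conj_conj(')`, `conj_app_congr`, `conj₃_app_congr`, `eq_conj_of_heq`);
* `liftη_precomp_mapPath` — abc-iut-f-101's pre-whiskering law `lift_precomp` for a family read along a graph embedding, with the
  lift of the pre-composing path SUPPLIED (no sieve hypothesis: in `D_{An•}` the observables' sub-diagrams are not sieves);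
  `LiftPair.isOver_hom` — over-ness of a lifting pair's homotopy from that of its presentation.

Pure category theory over abc-iut-L4-t2's honest Def. 3.5 definitions; nothing here bears on [IUTchIII] Cor. 3.12; no side taken.
-/

set_option autoImplicit false

universe u

open CategoryTheory Quiver

namespace Literature.AnabelianGeometry.AbsoluteAnabelian

/-! ## Bookkeeping: `eqToHom`-conjugated whiskerings (all functors variable, proofs by `subst`) -/

namespace DiagramOfCategories

section Shapes

variable {X' X B N : Type*} [Category X'] [Category X] [Category B] [Category N]

/-- `eqToHom` bookkeeping: a morphism conjugated twice by `eqToHom`s is conjugated once. (bookkeeping for the homotopies of Def 3.5 (ii)). [cite: MochizukiAbsTopIII2015, Definition 3.5 (ii) p.75] -/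
theorem eqToHom_conj_conj {C : Type*} [Category C] {a₁ a₂ a₃ b₁ b₂ b₃ : C} (f : a₃ ⟶ b₃) (h₁ : a₁ = a₂) (h₂ : a₂ = a₃)
    (h₃ : b₃ = b₂) (h₄ : b₂ = b₁) (h₅ : a₁ = a₃) (h₆ : b₃ = b₁) :
    eqToHom h₁ ≫ (eqToHom h₂ ≫ f ≫ eqToHom h₃) ≫ eqToHom h₄ = eqToHom h₅ ≫ f ≫ eqToHom h₆ := by
  subst h₁ h₂ h₃ h₄
  simp

/-- `eqToHom` bookkeeping, rewriting form: nested conjugations flatten. (bookkeeping for the homotopies of Def 3.5 (ii)). [cite: MochizukiAbsTopIII2015, Definition 3.5 (ii) p.75] -/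
theorem eqToHom_conj_conj' {C : Type*} [Category C] {a₁ a₂ a₃ b₁ b₂ b₃ : C} (f : a₃ ⟶ b₃) (h₁ : a₁ = a₂) (h₂ : a₂ = a₃)
    (h₃ : b₃ = b₂) (h₄ : b₂ = b₁) :
    eqToHom h₁ ≫ (eqToHom h₂ ≫ f ≫ eqToHom h₃) ≫ eqToHom h₄ = eqToHom (h₁.trans h₂) ≫ f ≫ eqToHom (h₃.trans h₄) := by
  subst h₁ h₂ h₃ h₄
  simp

/-- Conjugated components of one natural transformation at propositionally equal objects agree. (bookkeeping for the homotopies of Def 3.5 (ii)). [cite: MochizukiAbsTopIII2015, Definition 3.5 (ii) p.75] -/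
theorem conj_app_congr {A B : Type*} [Category A] [Category B] {F G : A ⥤ B} (α : F ⟶ G) {y y' : A} (hy : y = y')
    {X Y : B} (e₁ : X = F.obj y) (e₂ : G.obj y = Y) (e₃ : X = F.obj y') (e₄ : G.obj y' = Y) :
    eqToHom e₁ ≫ α.app y ≫ eqToHom e₂ = eqToHom e₃ ≫ α.app y' ≫ eqToHom e₄ := by
  subst hy
  rfl

/-- Triply conjugated components of one natural transformation at propositionally equal objects (the shape met when a pre-whiskered
observable homotopy is read on a composite path). (bookkeeping for the homotopies of Def 3.5 (ii)). [cite: MochizukiAbsTopIII2015, Definition 3.5 (ii) p.75] -/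
theorem conj₃_app_congr {A B : Type*} [Category A] [Category B] {F G : A ⥤ B} (α : F ⟶ G) {y y' : A} (hy : y = y')
    {X₀ X₁ X₂ Y₂ Y₁ Y₀ : B} (e₁ : X₀ = X₁) (e₂ : X₁ = X₂) (e₃ : X₂ = F.obj y) (e₄ : G.obj y = Y₂) (e₅ : Y₂ = Y₁) (e₆ : Y₁ = Y₀)
    (e₇ : X₀ = F.obj y') (e₈ : G.obj y' = Y₀) :
    eqToHom e₁ ≫ (eqToHom e₂ ≫ (eqToHom e₃ ≫ α.app y ≫ eqToHom e₄) ≫ eqToHom e₅) ≫ eqToHom e₆ =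
      eqToHom e₇ ≫ α.app y' ≫ eqToHom e₈ := by
  subst hy e₁ e₂ e₃ e₄ e₅ e₆
  simp

/-- `HEq` of morphisms with propositionally equal endpoints is conjugation by `eqToHom`s. (bookkeeping for the homotopies of Def 3.5 (ii)). [cite: MochizukiAbsTopIII2015, Definition 3.5 (ii) p.75] -/
theorem eq_conj_of_heq {C : Type*} [Category C] {a a' b b' : C} {f : a ⟶ b} {g : a' ⟶ b'} (h : HEq f g) (ha : a = a')
    (hb : b' = b) : f = eqToHom ha ≫ g ≫ eqToHom hb := by
  subst ha hb
  simp [eq_of_heq h]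

/-- The "outer shape" `eqToHom ≫ (h ▹ T ≫ S ◃ t) ≫ eqToHom` (lift whiskered by the tail, then observable homotopy whiskered by the head):
two such shapes with matching middle COMPOSE to the shape of the composites (naturality of `t₁` against `h₂`; Def 3.5 (ii), second
axiom). [cite: MochizukiAbsTopIII2015, Definition 3.5 (ii) p.75] -/
theorem outerShape_comp {S₀ S S₂ : X ⥤ B} (h₁ : S₀ ⟶ S) (h₂ : S ⟶ S₂) {T T' T'' : B ⥤ N} (t₁ : T ⟶ T') (t₂ : T' ⟶ T'')
    {P Q R : X ⥤ N} (eP : P = S₀ ⋙ T) (eQ eQ' : Q = S ⋙ T') (eR : R = S₂ ⋙ T'') :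
    (eqToHom eP ≫ (Functor.whiskerRight h₁ T ≫ Functor.whiskerLeft S t₁) ≫ eqToHom eQ.symm) ≫
        (eqToHom eQ' ≫ (Functor.whiskerRight h₂ T' ≫ Functor.whiskerLeft S₂ t₂) ≫ eqToHom eR.symm) =
      eqToHom eP ≫ (Functor.whiskerRight (h₁ ≫ h₂) T ≫ Functor.whiskerLeft S₂ (t₁ ≫ t₂)) ≫ eqToHom eR.symm := by
  subst eP eQ eR
  simp only [eqToHom_refl, Category.id_comp, Category.comp_id, Category.assoc, Functor.whiskerRight_comp,
    Functor.whiskerLeft_comp]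
  rw [← Category.assoc (Functor.whiskerLeft S t₁), Functor.whiskerLeft_comp_whiskerRight, Category.assoc]

set_option backward.defeqAttrib.useBackward true in
/-- Two outer shapes with trivial middle glue are one (re-bracketing). [cite: MochizukiAbsTopIII2015, Definition 3.5 (ii) p.75] -/
theorem outerShape_split {S₀ S : X ⥤ B} (h : S₀ ⟶ S) {T T' : B ⥤ N} (t : T ⟶ T') {P M Q : X ⥤ N} (eP : P = S₀ ⋙ T)
    (eM eM' : M = S ⋙ T) (eQ : Q = S ⋙ T') :
    (eqToHom eP ≫ Functor.whiskerRight h T ≫ eqToHom eM.symm) ≫ (eqToHom eM' ≫ Functor.whiskerLeft S t ≫ eqToHom eQ.symm) =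
      eqToHom eP ≫ (Functor.whiskerRight h T ≫ Functor.whiskerLeft S t) ≫ eqToHom eQ.symm := by
  subst eP eM eQ
  simp

set_option backward.defeqAttrib.useBackward true in
/-- The outer shape of identities is the identity (Def 3.5 (ii): `ζ_{([γ],[γ])} = id`). [cite: MochizukiAbsTopIII2015, Definition 3.5 (ii) p.75] -/
theorem outerShape_id {S : X ⥤ B} {T : B ⥤ N} {P : X ⥤ N} (eP eP' : P = S ⋙ T) :
    eqToHom eP ≫ (Functor.whiskerRight (𝟙 S) T ≫ Functor.whiskerLeft S (𝟙 T)) ≫ eqToHom eP'.symm = 𝟙 P := by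
  subst eP
  simp

set_option backward.defeqAttrib.useBackward true in
/-- The outer shape with trivial observable part. [cite: MochizukiAbsTopIII2015, Definition 3.5 (ii) p.75] -/
theorem outerShape_tail_id {S₀ S : X ⥤ B} (h : S₀ ⟶ S) {T : B ⥤ N} {P Q : X ⥤ N} (eP : P = S₀ ⋙ T) (eQ : Q = S ⋙ T) :
    eqToHom eP ≫ (Functor.whiskerRight h T ≫ Functor.whiskerLeft S (𝟙 T)) ≫ eqToHom eQ.symm =
      eqToHom eP ≫ Functor.whiskerRight h T ≫ eqToHom eQ.symm := by
  subst eP eQ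
  simp

set_option backward.defeqAttrib.useBackward true in
/-- The outer shape with trivial head. [cite: MochizukiAbsTopIII2015, Definition 3.5 (ii) p.75] -/
theorem outerShape_head_id {S : X ⥤ B} {T T' : B ⥤ N} (t : T ⟶ T') {P Q : X ⥤ N} (eP : P = S ⋙ T) (eQ : Q = S ⋙ T') :
    eqToHom eP ≫ (Functor.whiskerRight (𝟙 S) T ≫ Functor.whiskerLeft S t) ≫ eqToHom eQ.symm =
      eqToHom eP ≫ Functor.whiskerLeft S t ≫ eqToHom eQ.symm := by
  subst eP eQ
  simp

set_option backward.defeqAttrib.useBackward true in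
/-- Pre-whiskering an outer shape: `R ◃ (h ▹ T ≫ S ◃ t) = (R ◃ h) ▹ T ≫ (R ⋙ S) ◃ t` (Def 3.5 (ii), third axiom).
[cite: MochizukiAbsTopIII2015, Definition 3.5 (ii) p.75] -/
theorem whiskerLeft_outerShape (R : X' ⥤ X) {S₀ S : X ⥤ B} (h : S₀ ⟶ S) {T T' : B ⥤ N} (t : T ⟶ T') {P Q : X ⥤ N}
    (eP : P = S₀ ⋙ T) (eQ : Q = S ⋙ T') {P' Q' : X' ⥤ N} (eP' : P' = R ⋙ P) (eQ' : Q' = R ⋙ Q) {S₀' S' : X' ⥤ B}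
    (eS₀ : S₀' = R ⋙ S₀) (eS : S' = R ⋙ S) (eP'' : P' = S₀' ⋙ T) (eQ'' : Q' = S' ⋙ T') :
    eqToHom eP' ≫ Functor.whiskerLeft R (eqToHom eP ≫ (Functor.whiskerRight h T ≫ Functor.whiskerLeft S t) ≫ eqToHom eQ.symm) ≫
        eqToHom eQ'.symm =
      eqToHom eP'' ≫ (Functor.whiskerRight (eqToHom eS₀ ≫ Functor.whiskerLeft R h ≫ eqToHom eS.symm) T ≫
        Functor.whiskerLeft S' t) ≫ eqToHom eQ''.symm := by
  subst eP eQ eP' eQ' eS₀ eS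
  ext x
  simp

set_option backward.defeqAttrib.useBackward true in
/-- Pre-whiskering a plain conjugated whiskering: `R ◃ (S ◃ t)` as `(R ⋙ S) ◃ t`. [cite: MochizukiAbsTopIII2015, Definition 3.5 (ii) p.75] -/
theorem whiskerLeft_conj_whiskerLeft (R : X' ⥤ X) {S : X ⥤ B} {T T' : B ⥤ N} (t : T ⟶ T') {P Q : X ⥤ N} (eP : P = S ⋙ T)
    (eQ : Q = S ⋙ T') {P' Q' : X' ⥤ N} (eP' : P' = R ⋙ P) (eQ' : Q' = R ⋙ Q) {S' : X' ⥤ B} (eS : S' = R ⋙ S)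
    (eP'' : P' = S' ⋙ T) (eQ'' : Q' = S' ⋙ T') :
    eqToHom eP' ≫ Functor.whiskerLeft R (eqToHom eP ≫ Functor.whiskerLeft S t ≫ eqToHom eQ.symm) ≫ eqToHom eQ'.symm =
      eqToHom eP'' ≫ Functor.whiskerLeft S' t ≫ eqToHom eQ''.symm := by
  subst eP eQ eP' eQ' eS
  ext x
  simp

set_option backward.defeqAttrib.useBackward true in
/-- Post-whiskering a conjugated pre-whiskering IS pre-whiskering the conjugated post-whiskering: `(R ◃ α) ▹ K = R ◃ (α ▹ K)` up to
the displayed identifications. [cite: MochizukiAbsTopIII2015, Definition 3.5 (ii) p.75] -/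
theorem whiskerRight_conj_whiskerLeft (R : X' ⥤ X) {S₀ S : X ⥤ B} (α : S₀ ⟶ S) (K : B ⥤ N) {S₀' S' : X' ⥤ B}
    (eS₀ : S₀' = R ⋙ S₀) (eS : S' = R ⋙ S) {P' Q' : X' ⥤ N} (eP' : P' = S₀' ⋙ K) (eQ' : Q' = S' ⋙ K) {A A' : X ⥤ N}
    (eA : A = S₀ ⋙ K) (eA' : A' = S ⋙ K) (e₁ : P' = R ⋙ A) (e₂ : Q' = R ⋙ A') :
    eqToHom eP' ≫ Functor.whiskerRight (eqToHom eS₀ ≫ Functor.whiskerLeft R α ≫ eqToHom eS.symm) K ≫ eqToHom eQ'.symm =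
      eqToHom e₁ ≫ Functor.whiskerLeft R (eqToHom eA ≫ Functor.whiskerRight α K ≫ eqToHom eA'.symm) ≫ eqToHom e₂.symm := by
  subst eS₀ eS eP' eQ' eA eA'
  ext x
  simp

set_option backward.defeqAttrib.useBackward true in
/-- Components of a conjugated pre-whiskering (plain objects). [cite: MochizukiAbsTopIII2015, Definition 3.5 (ii) p.75] -/
theorem app_conj_whiskerLeft (R : X' ⥤ X) {P Q : X ⥤ N} (η : P ⟶ Q) {P' Q' : X' ⥤ N} (eP' : P' = R ⋙ P) (eQ' : Q' = R ⋙ Q)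
    (x : X') (h₁ : P'.obj x = P.obj (R.obj x)) (h₂ : Q.obj (R.obj x) = Q'.obj x) :
    (eqToHom eP' ≫ Functor.whiskerLeft R η ≫ eqToHom eQ'.symm).app x = eqToHom h₁ ≫ η.app (R.obj x) ≫ eqToHom h₂ := by
  subst eP' eQ'
  simp

set_option backward.defeqAttrib.useBackward true in
/-- Components of a conjugated post-whiskering (plain objects). [cite: MochizukiAbsTopIII2015, Definition 3.5 (ii) p.75] -/
theorem app_conj_whiskerRight {P Q : X ⥤ B} (η : P ⟶ Q) (K : B ⥤ N) {P' Q' : X ⥤ N} (eP' : P' = P ⋙ K) (eQ' : Q' = Q ⋙ K)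
    (x : X) (h₁ : P'.obj x = K.obj (P.obj x)) (h₂ : K.obj (Q.obj x) = Q'.obj x) :
    (eqToHom eP' ≫ Functor.whiskerRight η K ≫ eqToHom eQ'.symm).app x = eqToHom h₁ ≫ K.map (η.app x) ≫ eqToHom h₂ := by
  subst eP' eQ'
  simp

set_option backward.defeqAttrib.useBackward true in
/-- Post-whiskering a conjugated post-whiskering: `(θ ▹ K₁) ▹ K₂ = θ ▹ (K₁ ⋙ K₂)` with the conjugations moved out.
[cite: MochizukiAbsTopIII2015, Definition 3.5 (ii) p.75] -/
theorem whiskerRight_conj_whiskerRight {P Q : X ⥤ B} (θ : P ⟶ Q) (K₁ : B ⥤ N) {N' : Type*} [Category N'] (K₂ : N ⥤ N')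
    {P₁ Q₁ : X ⥤ N} (eP₁ : P₁ = P ⋙ K₁) (eQ₁ : Q₁ = Q ⋙ K₁) {P₂ Q₂ : X ⥤ N'} (eP₂ : P₂ = P₁ ⋙ K₂) (eQ₂ : Q₂ = Q₁ ⋙ K₂)
    (eP : P₂ = P ⋙ (K₁ ⋙ K₂)) (eQ : Q₂ = Q ⋙ (K₁ ⋙ K₂)) :
    eqToHom eP₂ ≫ Functor.whiskerRight (eqToHom eP₁ ≫ Functor.whiskerRight θ K₁ ≫ eqToHom eQ₁.symm) K₂ ≫ eqToHom eQ₂.symm =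
      eqToHom eP ≫ Functor.whiskerRight θ (K₁ ⋙ K₂) ≫ eqToHom eQ.symm := by
  subst eP₁ eQ₁ eP₂ eQ₂
  ext x
  simp

set_option backward.defeqAttrib.useBackward true in
/-- A conjugated post-whiskering does not see a propositional re-presentation of the whiskering functor. (bookkeeping for the homotopies of Def 3.5 (ii)). [cite: MochizukiAbsTopIII2015, Definition 3.5 (ii) p.75] -/
theorem whiskerRight_functor_congr {P Q : X ⥤ B} (η : P ⟶ Q) {K K' : B ⥤ N} (e : K = K') {P' Q' : X ⥤ N} (eP : P' = P ⋙ K)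
    (eQ : Q' = Q ⋙ K) (eP' : P' = P ⋙ K') (eQ' : Q' = Q ⋙ K') :
    eqToHom eP ≫ Functor.whiskerRight η K ≫ eqToHom eQ.symm = eqToHom eP' ≫ Functor.whiskerRight η K' ≫ eqToHom eQ'.symm := by
  subst e eP eQ
  rfl

end Shapes

/-! ## Inner pairs: pre-composition by a path already lifted (no sieve) -/

section InnerPrecomp

variable {V' : Type*} [Quiver V'] {V : Type*} [Quiver V] {F : V' ⥤q V} (D : DiagramOfCategories V) {ω : V'}
  (K : (D.comapAlong F).HomotopyFamily)

/-- **Pre-whiskering of an inner member by an INCLUDED path** (abc-iut-f-101's `lift_precomp` with the lift of the pre-composing path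
SUPPLIED instead of produced by a sieve): the member pair `(F r₀ ∘ γ₁, F r₀ ∘ γ₂)` with the pre-whiskered homotopy, componentwise.
[cite: MochizukiAbsTopIII2015, Definition 3.5 (ii) p.75] -/
theorem liftη_precomp_mapPath (hF : GraphEmbedding F) {a' : V'} {p q : Path (F.obj a') (F.obj ω)} (h : liftE F D ω K p q)
    {c' : V'} (r₀ : Path c' a') :
    ∃ h' : liftE F D ω K ((F.mapPath r₀).comp p) ((F.mapPath r₀).comp q), ∀ x : D.obj (F.obj c'),
      (liftη F D ω K h').app x = eqToHom (D.pathFunctor_comp_obj (F.mapPath r₀) p x) ≫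
        (liftη F D ω K h).app ((D.pathFunctor (F.mapPath r₀)).obj x) ≫ eqToHom (D.pathFunctor_comp_obj (F.mapPath r₀) q x).symm := by
  obtain ⟨w⟩ := h
  obtain ⟨src, left, right, mem, hs, hl, hq⟩ := w
  cases hF.obj_injective hs
  cases hl; cases hq
  have mem' : K.E (r₀.comp left) (r₀.comp right) := K.isSaturated.precomp (K.isSaturated.postcomp mem Path.nil) r₀
  have hp : F.mapPath (r₀.comp left) = (F.mapPath r₀).comp (F.mapPath left) := Prefunctor.mapPath_comp F r₀ left
  have hq : F.mapPath (r₀.comp right) = (F.mapPath r₀).comp (F.mapPath right) := Prefunctor.mapPath_comp F r₀ right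
  let w' : LiftPair F D ω K ((F.mapPath r₀).comp (F.mapPath left)) ((F.mapPath r₀).comp (F.mapPath right)) :=
    ⟨c', r₀.comp left, r₀.comp right, mem', rfl, heq_of_eq hp, heq_of_eq hq⟩
  refine ⟨⟨w'⟩, fun x => ?_⟩
  rw [liftη_eq hF _ w', liftη_eq hF _ (LiftPair.ofMem mem), LiftPair.hom_ofMem]
  have hw' : w'.hom = eqToHom _ ≫ (eqToHom (D.pathFunctor_comapAlong F (r₀.comp left)).symm ≫ K.η mem' ≫
      eqToHom (D.pathFunctor_comapAlong F (r₀.comp right))) ≫ eqToHom _ :=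
    D.transportHom_eq hp hq _
  have hw : K.η (p := r₀.comp left) (q := r₀.comp right) mem' = _ := K.η_whisker mem r₀ Path.nil
  rw [hw', hw]
  dsimp only [Path.comp_nil]
  simp only [NatTrans.comp_app, eqToHom_app, Category.assoc, Functor.whiskerLeft_app, Functor.whiskerRight_app]
  rw [pathFunctor_nil_map, OverData.app_congr_obj (K.η mem) (Functor.congr_obj (D.pathFunctor_comapAlong F r₀) x)]
  simp only [Category.assoc, eqToHom_trans, eqToHom_trans_assoc]
  exact eqToHom_conj_conj _ _ _ _ _ _ _

/-- The homotopy of an inner pair lies over the structure functors as soon as the homotopy of its presentation does (re-indexing an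
over-homotopy along equal pairs keeps it over). [cite: MochizukiAbsTopIII2015, Remark 3.5.1 p.78] -/
theorem LiftPair.isOver_hom {C : Type*} [Category C] (O : D.OverData C)
    (hover : ∀ {a' : V'} (p q : Path a' ω) (h : K.E p q), O.IsOver (F.mapPath p) (F.mapPath q) (LiftPair.ofMem (D := D) h).hom)
    {a : V} {p q : Path a (F.obj ω)} (w : LiftPair F D ω K p q) : O.IsOver p q w.hom := by
  obtain ⟨src, left, right, mem, hs, hl, hq⟩ := w
  subst hs
  cases hl; cases hq
  exact hover left right mem

end InnerPrecomp

end DiagramOfCategories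

end Literature.AnabelianGeometry.AbsoluteAnabelian
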